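import Literature.AlgebraicGeometry.HodgeTheory.ArapuraSurfaceFibredFourfoldsProofs
import Literature.AlgebraicGeometry.Resolution.ProjectiveResolutionProofs
import HarnessLib

/-!
# Arapura 2022, Cor. 1.5 (fourfolds fibred over a surface by `p_g = 0` surfaces): split record

Family `hodge`, layer `Literature/AlgebraicGeometry/HodgeTheory`. Split record (librarian,
fact-decompose) for the named fact
`Literature.AlgebraicGeometry.HodgeTheory.Arapura2022_hodgeConjecture_pgZeroSurfaceFibration`
(`ArapuraSurfaceFibredFourfolds.lean`: D. Arapura, *Hodge cycles and the Leray filtration*, Pacific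
J. Math. 319 (2022) 233–258 = arXiv:2103.05038, Cor. 1.5: the Hodge conjecture holds for a smooth
projective fourfold `X` fibred, with connected fibres, over a smooth projective surface `Y` by
surfaces of geometric genus zero).

The printed proof has four layers (module docstring of `ArapuraSurfaceFibredFourfoldsProofs.lean`):
(1) Lefschetz `(1,1)` and hard Lefschetz for the codimensions `p ≠ 2` on a fourfold; (2) Jannsen's
theorem / Lemma 1.2 (localisation: the conjecture for `U ⊂ X` and for `Z = X ∖ U`, of dimension
`≤ 3`, gives it for `X`); (3) Thm. 1.2 — the Hodge conjecture for the smooth part `V = f⁻¹U → U`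
from the surjectivity of the Leray-graded cycle maps; (4) Cor. 1.5 proper — for `dim Y = 2` and
`p_g = 0` fibres the hypothesis of Thm. 1.2 holds (relative divisors span `R²f_*ℚ`, Lefschetz
`(1,1)` on the base). Layers 1–2 are PROVED on the tree's real carriers from existing named facts
(`Arapura2022_hodgeConjecture_pgZeroSurfaceFibration_of_localization'`, with the support property of
Gysin maps, Poincaré duality and — here — projective Hironaka
(`Resolution.Hironaka1964_projective_holds`) discharged); layers 3–4 have no carrier in the tree
(Leray filtration, `Rⁱf_*ℚ`, mixed Hodge structures on open varieties, perverse hard Lefschetz,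
relative Hilbert schemes) and were carried as the hypothesis `hVpart`. This file NAMES that
hypothesis (verbatim) and records the split:

Children (7): the EXISTING named facts
`lefschetzOneOne_rational` (Voisin I, Thm. 11.30), `nonempty_hardLefschetzNFold 4 X` for all `X`
(Voisin I, Thm. 6.25), `hodgeClasses_algebraic_of_dim_le_three` (the conjecture in dimension `≤ 3`),
`nonempty_hodgeModel` (existence of Hodge models, GAGA + Hodge decomposition),
`Deligne1974_ker_restrictCompl_eq_iSup_range_complexGysin` (Hodge III, Cor. 8.2.8),
`Voisin2025_hodgeClass_lift_complexGysin` (Voisin 2025, Cor. 2.12), and the NEW named fact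
`Arapura2022_thm_1_2_smoothPart_pgZeroSurfaceFibration` (layers 3–4: Thm. 1.2 applied as in
the proof of Cor. 1.5 — "the Hodge conjecture holds for `V`" for the `(2,2)`-classes of `X`).

Assembly (PROVED): `Arapura2022_hodgeConjecture_pgZeroSurfaceFibration_holds_of`. The new child
does not restate the parent: it asserts algebraicity of the rational `(2,2)`-classes of `X` only
UP TO classes dying off a vertical divisor `f⁻¹T` (the output of Thm. 1.2 on `V = f⁻¹(Y ∖ T)`),
in the single degree `4`; the parent is the full conjecture in all degrees. Conversely the parent
gives the child with `T = ∅`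
(`Arapura2022_hodgeConjecture_pgZeroSurfaceFibration.localization_residual`, proved), so nothing
stronger than Cor. 1.5 is asserted. (Seven children: one more than the fact-decompose guideline of
six, because the landed assembly consumes exactly these six classical facts plus the residual; all
six are shared with the other known cases of the Hodge conjecture in the tree.)

## References

* [Arapura2022] D. Arapura, *Hodge cycles and the Leray filtration*, Pacific J. Math. 319 (2022)
  233–258, doi:10.2140/pjm.2022.319.233 = arXiv:2103.05038: §1, Thm. 1.1, Lemma 1.2, Thm. 1.2,
  Cor. 1.4, Cor. 1.5 (pp. 3–5).
* [Jannsen1990MixedMotives] U. Jannsen, *Mixed Motives and Algebraic K-Theory*, LNM 1400 (1990).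
* [VoisinHodgeI2002] C. Voisin, *Hodge Theory and Complex Algebraic Geometry I*, Thm. 6.25, Thm. 11.30.
* [DeligneHodgeIII1974] P. Deligne, *Théorie de Hodge III*, Publ. Math. IHÉS 44 (1974), Cor. 8.2.8.
* [Voisin2025] C. Voisin, J. Open Math. Probl. 1 (2025), Cor. 2.12.
* [Hironaka1964] H. Hironaka, Ann. of Math. 79 (1964), Main Theorem I; [Kollar2007] Thm. 3.27.
-/

noncomputable section

open AlgebraicGeometry
open Literature.AlgebraicTopology.SingularHomology

namespace Literature.AlgebraicGeometry.HodgeTheory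

section HodgeTheory

/-! ### The new child: the output of Thm. 1.2 for `V = f⁻¹U` (layers 3–4 of the printed proof) -/

/-- NAMED FACT — **Arapura 2022, Thm. 1.2 as applied in the proof of Cor. 1.5: rational
`(2,2)`-classes of the total space of a `p_g = 0` surface fibration over a surface are algebraic on
the smooth part `V = f⁻¹U`.** Source: Cor. 1.4, "If the cycle map `□^{2,m} : Gr^m_L CH²(V) →
Hodge(H^m(U, R^{4-m}f_*ℚ)(2))` is surjective, then [the rational `(p,p)`-classes of `X` are
algebraic]" — whose printed proof is "by Thm. 1.2 [this] holds for `V`", `V = f⁻¹U`, `U ⊂ Y` a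
non-empty Zariski open set over which `f` is smooth (§1, p. 3), followed by Lemma 1.2 / Thm. 1.1 —
together with the proof of Cor. 1.5 (p. 5), which verifies the surjectivity hypothesis for
`dim Y = 2`, `p_g(X_y) = 0`: "by the Lefschetz `(1,1)` theorem, there exist irreducible divisors
`Z_1, …, Z_N ⊂ X_y` which span `H²(X_y, ℚ)` … after a finite base change, `[𝒵_1], …, [𝒵_N]`
gives a basis of `R²f_*ℚ` … `H²(U, R²f_*ℚ) ≅ ⊕ H²(U, ℚ) ∪ [𝒵_i]` … The Lefschetz `(1,1)` theorem
now shows that `Hodge(H²(U, R²f_*ℚ)(2))` is spanned by algebraic cycles." This is a THEOREM in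
print (Thm. 1.2 + the computation of Cor. 1.5), not an open statement. Rendering (verbatim the
hypothesis `hVpart` of the landed localisation theorem `…_of_localization'` of
`ArapuraSurfaceFibredFourfoldsProofs.lean`): under the hypotheses of
Cor. 1.5 in the tree's spelling (as in the parent fact), there is a proper Zariski-closed `T ⊊ |Y|`
(`U = Y ∖ T`) such that every rational class of Hodge type `(2,2)` in `H⁴(X(ℂ); ℂ)` agrees on
`(X ∖ f⁻¹T)(ℂ) = V(ℂ)` with an algebraic class of `X` — i.e. the restriction of the class to `V`
is the class of an algebraic cycle on `V` (closures of cycles on `V` are cycles on `X`). Printed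
proof: Deligne's degeneration of the Leray spectral sequence, Arapura's mixed Hodge structures on
`Gr_L H⁴(V)`, the decomposition theorem and perverse hard Lefschetz over `U` [BBD], Peters–Saito,
relative Hilbert schemes and the trace of a finite base change — none of which has a carrier in
the tree. The parent fact (Cor. 1.5, `ArapuraSurfaceFibredFourfolds.lean`) gives this statement back with
`T = ∅` (its `.localization_residual`, proved), so it is weaker than the established Cor. 1.5. Users take
`(h : Arapura2022_thm_1_2_smoothPart_pgZeroSurfaceFibration)`.
[cite: Arapura2022, Thm. 1.2, Cor. 1.4 (proof) and proof of Cor. 1.5 (p. 5)] -/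
def Arapura2022_thm_1_2_smoothPart_pgZeroSurfaceFibration : Prop :=
  ∀ ⦃X Y : Motives.SchemeOver ℂ⦄ (f : X ⟶ Y),
    Motives.IsSmoothProjective 4 X → Motives.IsSmoothProjective 2 Y →
    Function.Surjective f.left.base →
    (∀ y : Y.left, IsPreconnected (f.left.base ⁻¹' {y})) →
    (∃ T : Set Y.left, IsClosed T ∧ T ≠ Set.univ ∧
      ∀ s : Motives.AlgPoints Y ℂ, s.pt ∉ T →
        Motives.IsSmoothProjective 2 (Motives.fiberOver f s) ∧
        ∃ A : HodgeModel 2 (Motives.fiberOver f s), Module.finrank ℂ ↥(A.hodgePQ 2 2 0) = 0) →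
    ∃ T : Set Y.left, IsClosed T ∧ T ≠ Set.univ ∧
      ∀ c : complexBetti X (2 * 2), IsRationalClass c → IsOfHodgeType 4 X (2 * 2) 2 2 c →
        ∃ b ∈ algebraicClasses X 2,
          complexBetti.restrictCompl X (f.left.base ⁻¹' T) (2 * 2) (c - b) = 0

/-! ### Assembly (proved) -/

/-- **Split assembly for Arapura's Cor. 1.5** (`Arapura2022_hodgeConjecture_pgZeroSurfaceFibration`)
from its seven named-fact children: Lefschetz `(1,1)` (`hL`), hard Lefschetz for fourfolds (`hHL`),
the Hodge conjecture in dimension `≤ 3` (`h3`), Hodge models (`hA`), Deligne's Cor. 8.2.8 (`hD`),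
Voisin's Cor. 2.12 (`hV`) and the output of Thm. 1.2 on the smooth part (`hVpart`); projective
Hironaka is the tree's theorem `Resolution.Hironaka1964_projective_holds`. Proof:
`Arapura2022_hodgeConjecture_pgZeroSurfaceFibration_of_localization'`.
[cite: Arapura2022, Cor. 1.5, Cor. 1.4, Thm. 1.2, Lemma 1.2 and Thm. 1.1] -/
theorem Arapura2022_hodgeConjecture_pgZeroSurfaceFibration_holds_of
    (hL : lefschetzOneOne_rational)
    (hHL : ∀ X : Motives.SchemeOver ℂ, nonempty_hardLefschetzNFold 4 X)
    (h3 : hodgeClasses_algebraic_of_dim_le_three)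
    (hA : ∀ (m : ℕ) (Y : Motives.SchemeOver ℂ), nonempty_hodgeModel m Y)
    (hD : Deligne1974_ker_restrictCompl_eq_iSup_range_complexGysin)
    (hV : Voisin2025_hodgeClass_lift_complexGysin)
    (hVpart : Arapura2022_thm_1_2_smoothPart_pgZeroSurfaceFibration) :
    Arapura2022_hodgeConjecture_pgZeroSurfaceFibration :=
  Arapura2022_hodgeConjecture_pgZeroSurfaceFibration_of_localization' hL hHL h3 hA hD hV
    Resolution.Hironaka1964_projective_holds hVpart

end HodgeTheory

end Literature.AlgebraicGeometry.HodgeTheory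

end
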